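import Literature.MathematicalPhysics.QuantumFieldTheory.Balaban1983to89.B1Eq324BenfattoSect5PerBoxAtPavement
import Literature.MathematicalPhysics.QuantumFieldTheory.Balaban1983to89.B1Eq324BenfattoSect5IdErrBounds
import Literature.MathematicalPhysics.QuantumFieldTheory.Balaban1983to89.B1Eq324BenfattoAppendixC2
import Literature.MathematicalPhysics.QuantumFieldTheory.Balaban1983to89.B1Eq324BenfattoSect5ErrTermLedger
import HarnessLib

/-!
# Benfatto et al. 1978, §5 — the per-box error `Err(□)` of `…Sect5PerBoxAtPavement.perBox_at_pavement` is bounded UNIFORMLY IN THE BOX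

doc: Literature/MathematicalPhysics/QuantumFieldTheory/Balaban1983to89/B1Eq324BenfattoLemma.md

`perBox_at_pavement` (and the packaged steps `…Sect5StepBound.exists_lower_step ∕ exists_upper_step`) produce, for each tessera `□_m` meeting `J`,
a closed error `Err(□_m)` depending on `m` only through `|shrink L m w| ≤ L^d` (`…Sect5Eq524.card_shrink_le`) and through the Appendix-C weight
`Σ_{c ∈ Γ₁(□_m)} (1 + d(Δ_c, I)) ≤ L^d (1 + √d (L − 1))` (every site of a tessera meeting `J ⊆ I` is within cube distance `√d(L−1)` of `I`).
`perBoxErr_le` records the resulting `m`-free bound `Err(□_m) ≤ ErrPB(b, A, L, w, v, …)`, so that the chain ledger can charge `|B|·ErrPB ≤ |I|·ErrPB`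
per step (print: the `O(b^{−1/4})`, `O(e^{−ϰb})`, `O(e^{−b²/4})` per-box errors of (5.22), (5.26), (5.29)–(5.31) summed over the `≤ |I|` boxes, p.159).
[cite: BenfattoEtAl1978, (5.22) p.156, (5.24) p.157, (5.29)–(5.31) p.157–158, «Collecting all the errors» p.159]

## Theorems
* `cubeDist_le_of_mem_box` — two sites of one tessera are within cube distance `√d(L−1)`.
* `distToRegion_le_of_mem_box` — a site of a tessera meeting `I` is within `√d(L−1)` of `I`.
* `sum_frame1_one_add_distToRegion_le` — `Σ_{c∈Γ₁(□)}(1 + d(Δ_c,I)) ≤ L^d(1 + √d(L−1))` for `□` meeting `J ⊆ I`.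
* ★ `perBoxErr_le` — `Err(□_m) ≤ ErrPB` (the `m`-free bound).
* `geom_nonneg`, `err_shape_nonneg`, `errPB_nonneg` — `0 ≤ ErrPB`.
-/

namespace Literature.MathematicalPhysics.QuantumFieldTheory.Balaban1983to89.B1Eq324BenfattoSect5PerBoxErrBound

open MeasureTheory ProbabilityTheory Finset
open scoped BigOperators Nat
open Literature.Probability.LatticeModels (setPartitions)
open Literature.MathematicalPhysics.QuantumFieldTheory
open Literature.MathematicalPhysics.QuantumFieldTheory.Balaban1983to89.B1Eq324BenfattoLemma
open Literature.MathematicalPhysics.QuantumFieldTheory.Balaban1983to89.B1Eq324BenfattoSect5Boxes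
open Literature.MathematicalPhysics.QuantumFieldTheory.Balaban1983to89.B1Eq324BenfattoSect5Eq511
open Literature.MathematicalPhysics.QuantumFieldTheory.Balaban1983to89.B1Eq324BenfattoSect5Eq524
open Literature.MathematicalPhysics.QuantumFieldTheory.Balaban1983to89.B1Eq324BenfattoSect5Eq534
open Literature.MathematicalPhysics.QuantumFieldTheory.Balaban1983to89.B1Eq324BenfattoSect5Eq515
open Literature.MathematicalPhysics.QuantumFieldTheory.Balaban1983to89.B1Eq324BenfattoSect5IdErrBounds (latticeSumConst_nonneg)
open Literature.MathematicalPhysics.QuantumFieldTheory.Balaban1983to89.B1Eq324GaussianMomentLeaf (momentConst)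
open Literature.MathematicalPhysics.QuantumFieldTheory.Balaban1983to89.B1Eq324BenfattoAppendixC2 (freeCov_nonneg)
open Literature.MathematicalPhysics.QuantumFieldTheory.Balaban1983to89.B1Eq324BenfattoSect5ErrTermLedger (s1Const_nonneg)

variable {d : ℕ}

/-- Two sites of one tessera `□_m` of side `L ≥ 1` are within cube distance `√d·(L−1)` of each other. [cite: BenfattoEtAl1978, (5.7) p.154, after (2.3) p.146] -/
theorem cubeDist_le_of_mem_box {L : ℕ} (hL : 0 < L) {m x y : B1Eq324BenfattoLemma.Site d} (hx : x ∈ box L m) (hy : y ∈ box L m) :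
    cubeDist x y ≤ Real.sqrt d * ((L : ℝ) - 1) := by
  have hL1 : (0 : ℝ) ≤ (L : ℝ) - 1 := by
    have : (1 : ℝ) ≤ L := by exact_mod_cast hL
    linarith
  have hcoord : ∀ j, max (|((x j : ℝ) - (y j : ℝ))| - 1) 0 ≤ (L : ℝ) - 1 := by
    intro j
    obtain ⟨hx1, hx2⟩ := (mem_box_iff.mp hx) j
    obtain ⟨hy1, hy2⟩ := (mem_box_iff.mp hy) j
    have h1 : (x j : ℝ) - (y j : ℝ) ≤ (L : ℝ) - 1 := by
      have : x j - y j ≤ (L : ℤ) - 1 := by linarith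
      exact_mod_cast this
    have h2 : (y j : ℝ) - (x j : ℝ) ≤ (L : ℝ) - 1 := by
      have : y j - x j ≤ (L : ℤ) - 1 := by linarith
      exact_mod_cast this
    have habs : |((x j : ℝ) - (y j : ℝ))| ≤ (L : ℝ) - 1 := abs_sub_le_iff.mpr ⟨h1, h2⟩
    exact max_le (by linarith) hL1
  unfold cubeDist
  have hsum : ∑ j, max (|((x j : ℝ) - (y j : ℝ))| - 1) 0 ^ 2 ≤ (d : ℝ) * ((L : ℝ) - 1) ^ 2 := by
    calc ∑ j, max (|((x j : ℝ) - (y j : ℝ))| - 1) 0 ^ 2 ≤ ∑ _j : Fin d, ((L : ℝ) - 1) ^ 2 :=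
          Finset.sum_le_sum fun j _ => pow_le_pow_left₀ (le_max_right _ _) (hcoord j) 2
      _ = (d : ℝ) * ((L : ℝ) - 1) ^ 2 := by rw [Finset.sum_const, Finset.card_univ, Fintype.card_fin, nsmul_eq_mul]
  calc Real.sqrt (∑ j, max (|((x j : ℝ) - (y j : ℝ))| - 1) 0 ^ 2) ≤ Real.sqrt ((d : ℝ) * ((L : ℝ) - 1) ^ 2) := Real.sqrt_le_sqrt hsum
    _ = Real.sqrt d * ((L : ℝ) - 1) := by rw [Real.sqrt_mul (Nat.cast_nonneg d), Real.sqrt_sq hL1]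

/-- A site of a tessera `□_m` meeting `I` is within cube distance `√d(L−1)` of the region `I`: `d(Δ_c, I) ≤ √d(L−1)`.
[cite: BenfattoEtAl1978, after (2.3) p.146, (5.7) p.154] -/
theorem distToRegion_le_of_mem_box {L : ℕ} (hL : 0 < L) {I : Finset (B1Eq324BenfattoLemma.Site d)} {m c y : B1Eq324BenfattoLemma.Site d}
    (hc : c ∈ box L m) (hy : y ∈ box L m) (hyI : y ∈ I) : distToRegion I c ≤ Real.sqrt d * ((L : ℝ) - 1) := by
  have hI : I.Nonempty := ⟨y, hyI⟩
  rw [distToRegion, dif_pos hI]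
  exact (Finset.inf'_le _ hyI).trans (cubeDist_le_of_mem_box hL hc hy)

/-- **The Appendix-C weight of a tessera meeting `J ⊆ I`**: `Σ_{c ∈ Γ₁(□_m)} (1 + d(Δ_c, I)) ≤ L^d · (1 + √d(L−1))` (`|Γ₁(□)| ≤ L^d`, each term
`≤ 1 + √d(L−1)`). [cite: BenfattoEtAl1978, (5.7) p.154, Appendix C (C.8) p.164] -/
theorem sum_frame1_one_add_distToRegion_le {L w : ℕ} (hL : 0 < L) {I J : Finset (B1Eq324BenfattoLemma.Site d)} (hJI : J ⊆ I)
    {m : B1Eq324BenfattoLemma.Site d} (hm : m ∈ J.image (boxIndex L)) :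
    ∑ c ∈ frame1 L w m, (1 + distToRegion I c) ≤ (L : ℝ) ^ d * (1 + Real.sqrt d * ((L : ℝ) - 1)) := by
  obtain ⟨y, hy, rfl⟩ := Finset.mem_image.mp hm
  have hyb : y ∈ box L (boxIndex L y) := mem_box_boxIndex hL y
  have hsub : frame1 L w (boxIndex L y) ⊆ box L (boxIndex L y) := by rw [frame1]; exact Finset.sdiff_subset
  have hterm : ∀ c ∈ frame1 L w (boxIndex L y), 1 + distToRegion I c ≤ 1 + Real.sqrt d * ((L : ℝ) - 1) :=
    fun c hc => by linarith [distToRegion_le_of_mem_box hL (hsub hc) hyb (hJI hy)]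
  have hnn : 0 ≤ 1 + Real.sqrt d * ((L : ℝ) - 1) := by
    have : (1 : ℝ) ≤ L := by exact_mod_cast hL
    nlinarith [Real.sqrt_nonneg (d : ℝ)]
  calc ∑ c ∈ frame1 L w (boxIndex L y), (1 + distToRegion I c) ≤ ∑ _c ∈ frame1 L w (boxIndex L y), (1 + Real.sqrt d * ((L : ℝ) - 1)) :=
        Finset.sum_le_sum hterm
    _ = ((frame1 L w (boxIndex L y)).card : ℝ) * (1 + Real.sqrt d * ((L : ℝ) - 1)) := by rw [Finset.sum_const, nsmul_eq_mul]
    _ ≤ (L : ℝ) ^ d * (1 + Real.sqrt d * ((L : ℝ) - 1)) := by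
        refine mul_le_mul_of_nonneg_right ?_ hnn
        have h1 : (frame1 L w (boxIndex L y)).card ≤ (box L (boxIndex L y)).card := Finset.card_le_card hsub
        have h2 : (box L (boxIndex L y)).card ≤ L ^ d := by rw [← shrink_zero]; exact card_shrink_le L _ 0
        exact_mod_cast h1.trans h2

/-- ★ **The per-box error is bounded uniformly in the box**: for `□_m` meeting `J ⊆ I`, the closed `Err(□_m)` of
`…Sect5PerBoxAtPavement.perBox_at_pavement` (≡ the `Err m` of `…Sect5StepBound.exists_lower_step ∕ exists_upper_step`) is at most the same expression with
`|shrink L m w| ↦ L^d` and `Σ_{c∈Γ₁(□_m)}(1 + d(Δ_c, I)) ↦ L^d(1 + √d(L−1))` — an `m`-free quantity `ErrPB`; hence `Σ_{□∈B} Err(□) ≤ |B|·ErrPB`.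
[cite: BenfattoEtAl1978, (5.22) p.156, (5.24) p.157, (5.29)–(5.31) p.157–158, p.159] -/
theorem perBoxErr_le {α β : ℝ} (hα : 0 < α) (hβ : 0 < β) {s D : ℕ} {κ : ℝ} (hκ : 0 ≤ κ) {A : ℝ} (hA : 0 ≤ A) {L w v : ℕ} (hL : 0 < L)
    {I J : Finset (B1Eq324BenfattoLemma.Site d)} (hJI : J ⊆ I) {m : B1Eq324BenfattoLemma.Site d} (hm : m ∈ J.image (boxIndex L))
    {γ b : ℝ} (hγ : 0 ≤ γ) (hb : 0 ≤ b) {δ : ℝ} (hres : 0 ≤ κ / 2 - δ / 2 * ((D : ℝ) ^ 2 * Real.sqrt d)) (t : ℕ) :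
    (fun m : B1Eq324BenfattoLemma.Site d =>
        let M : ℝ := A * (L : ℝ) ^ d * ∑ p ∈ Finset.Icc 1 s, ((admissible p D).card : ℝ) *
            ((2 / (1 - Real.exp (-(κ / 2 / (p : ℕ) / Real.sqrt d))) * Real.exp (κ / 2 / (p : ℕ) / Real.sqrt d)) ^ d) ^ (p - 1)
        let Mt : ℝ := A * Real.exp (δ / 2 * ((D : ℝ) ^ 2 * d)) * (L : ℝ) ^ d * ∑ p ∈ Finset.Icc 1 s, ((admissible p D).card : ℝ) *
            ((2 / (1 - Real.exp (-((κ / 2 - δ / 2 * ((D : ℝ) ^ 2 * Real.sqrt d)) / (p : ℕ) / Real.sqrt d))) *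
              Real.exp ((κ / 2 - δ / 2 * ((D : ℝ) ^ 2 * Real.sqrt d)) / (p : ℕ) / Real.sqrt d)) ^ d) ^ (p - 1)
        let K : ℝ := 4 * (s1Const s D d κ * A * b ^ D * (L : ℝ) ^ d)
        let ε : ℝ := s1Const s D d κ * A * b ^ D * Real.exp (-(κ / 4 * v)) * (L : ℝ) ^ d
        let W : ℝ := 3 * (((shrink L m w).card : ℝ) * Real.exp (-(b ^ 2 / 4)))
        let cχ : ℕ → ℝ := fun k => 2 ^ k * ((∑ π ∈ setPartitions (univ : Finset (Fin k)), ((π.card - 1)! : ℝ)) *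
            ((min 1 (2 * ((shrink L m w).card : ℝ) * Real.exp (-(b ^ 2 / 4)))) ^ ((2 * k : ℕ) : ℝ)⁻¹ *
              ((1 + (1 + 2 * d / α ^ 2) * (γ * b)) ^ D * M * momentConst D (2 * k) (freeCov d α β 0 0).toNNReal) ^ k))
        let K₀ : ℝ := max (max 1 (freeCov d α β 0 0)) ((1 + 2 * d / α ^ 2) * (γ * b))
        let ε₃₁ : ℝ := max (β * (2 * d * (freeCov d α β 0 0 * (2 * d / (2 * d + α ^ 2)) ^ (w - v))) *
              (γ * b * ∑ c ∈ frame1 L w m, (1 + distToRegion I c)))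
            (2 * d * freeCov d α β 0 0 * (2 * d / (2 * d + α ^ 2)) ^ (w - v) / α ^ 2)
        let δ₂₉ : ℕ → ℝ := fun k => 2 ^ (k * D) * 2 ^ 2 ^ (k * D) * K₀ ^ (k * D) * Real.exp (-(δ / 2 * ((v : ℝ) + 1))) * Mt ^ k
        let δ₃₁ : ℕ → ℝ := fun k => M ^ k * (2 ^ (k * D) * 2 ^ 2 ^ (k * D) * ((k * D : ℕ) * K₀ ^ (k * D) * ε₃₁))
        let Err : ℝ := 2 * (2 ^ ((t + 1).choose 2) * K ^ (t + 1) / (t + 1)!) + Real.exp (2 * K) * W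
            + ∑ k ∈ Finset.range t,
                (3 ^ (k + 1) * ((∑ π ∈ setPartitions (univ : Finset (Fin (k + 1))), ((π.card - 1)! : ℝ)) * (ε * K ^ k))
                  + 3 ^ (k + 1) * (cχ (k + 1) + δ₂₉ (k + 1)) + 3 ^ (k + 1) * (cχ (k + 1) + δ₃₁ (k + 1))) / (k + 1)!
        Err) m ≤
    (let M : ℝ := A * (L : ℝ) ^ d * ∑ p ∈ Finset.Icc 1 s, ((admissible p D).card : ℝ) *
            ((2 / (1 - Real.exp (-(κ / 2 / (p : ℕ) / Real.sqrt d))) * Real.exp (κ / 2 / (p : ℕ) / Real.sqrt d)) ^ d) ^ (p - 1)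
        let Mt : ℝ := A * Real.exp (δ / 2 * ((D : ℝ) ^ 2 * d)) * (L : ℝ) ^ d * ∑ p ∈ Finset.Icc 1 s, ((admissible p D).card : ℝ) *
            ((2 / (1 - Real.exp (-((κ / 2 - δ / 2 * ((D : ℝ) ^ 2 * Real.sqrt d)) / (p : ℕ) / Real.sqrt d))) *
              Real.exp ((κ / 2 - δ / 2 * ((D : ℝ) ^ 2 * Real.sqrt d)) / (p : ℕ) / Real.sqrt d)) ^ d) ^ (p - 1)
        let K : ℝ := 4 * (s1Const s D d κ * A * b ^ D * (L : ℝ) ^ d)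
        let ε : ℝ := s1Const s D d κ * A * b ^ D * Real.exp (-(κ / 4 * v)) * (L : ℝ) ^ d
        let W : ℝ := 3 * (((L : ℝ) ^ d) * Real.exp (-(b ^ 2 / 4)))
        let cχ : ℕ → ℝ := fun k => 2 ^ k * ((∑ π ∈ setPartitions (univ : Finset (Fin k)), ((π.card - 1)! : ℝ)) *
            ((min 1 (2 * ((L : ℝ) ^ d) * Real.exp (-(b ^ 2 / 4)))) ^ ((2 * k : ℕ) : ℝ)⁻¹ *
              ((1 + (1 + 2 * d / α ^ 2) * (γ * b)) ^ D * M * momentConst D (2 * k) (freeCov d α β 0 0).toNNReal) ^ k))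
        let K₀ : ℝ := max (max 1 (freeCov d α β 0 0)) ((1 + 2 * d / α ^ 2) * (γ * b))
        let ε₃₁ : ℝ := max (β * (2 * d * (freeCov d α β 0 0 * (2 * d / (2 * d + α ^ 2)) ^ (w - v))) *
              (γ * b * ((L : ℝ) ^ d * (1 + Real.sqrt d * ((L : ℝ) - 1)))))
            (2 * d * freeCov d α β 0 0 * (2 * d / (2 * d + α ^ 2)) ^ (w - v) / α ^ 2)
        let δ₂₉ : ℕ → ℝ := fun k => 2 ^ (k * D) * 2 ^ 2 ^ (k * D) * K₀ ^ (k * D) * Real.exp (-(δ / 2 * ((v : ℝ) + 1))) * Mt ^ k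
        let δ₃₁ : ℕ → ℝ := fun k => M ^ k * (2 ^ (k * D) * 2 ^ 2 ^ (k * D) * ((k * D : ℕ) * K₀ ^ (k * D) * ε₃₁))
        let Err : ℝ := 2 * (2 ^ ((t + 1).choose 2) * K ^ (t + 1) / (t + 1)!) + Real.exp (2 * K) * W
            + ∑ k ∈ Finset.range t,
                (3 ^ (k + 1) * ((∑ π ∈ setPartitions (univ : Finset (Fin (k + 1))), ((π.card - 1)! : ℝ)) * (ε * K ^ k))
                  + 3 ^ (k + 1) * (cχ (k + 1) + δ₂₉ (k + 1)) + 3 ^ (k + 1) * (cχ (k + 1) + δ₃₁ (k + 1))) / (k + 1)!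
        Err) := by
  have hcard : ((shrink L m w).card : ℝ) ≤ (L : ℝ) ^ d := by exact_mod_cast card_shrink_le L m w
  have hfr := sum_frame1_one_add_distToRegion_le (w := w) hL hJI hm
  have hC : 0 ≤ freeCov d α β 0 0 := freeCov_nonneg hα hβ 0 0
  have hM1 := latticeSumConst_nonneg (s := s) (D := D) (d := d) (c := κ / 2) (by linarith)
  have hM2 := latticeSumConst_nonneg (s := s) (D := D) (d := d) (c := κ / 2 - δ / 2 * ((D : ℝ) ^ 2 * Real.sqrt d)) hres
  have hmc : ∀ n : ℕ, 0 ≤ momentConst D n (freeCov d α β 0 0).toNNReal := fun n => by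
    unfold momentConst; positivity
  simp only []
  gcongr
  all_goals first
    | exact hcard
    | exact hfr
    | positivity
    | exact pow_nonneg (mul_nonneg (mul_nonneg (by positivity) (mul_nonneg (mul_nonneg hA (by positivity)) hM1)) (hmc _)) _

/-- The geometric lattice factor `2/(1 − e^{−x})·e^{x}` is non-negative for `x ≥ 0` (for `x = 0` it is `2/0·1 = 0` by the field convention).
[cite: BenfattoEtAl1978, Appendix D (D.3) p.165] -/
theorem geom_nonneg {x : ℝ} (hx : 0 ≤ x) : 0 ≤ 2 / (1 - Real.exp (-x)) * Real.exp x := by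
  refine mul_nonneg (div_nonneg (by norm_num) ?_) (Real.exp_pos _).le
  have : Real.exp (-x) ≤ 1 := Real.exp_le_one_iff.mpr (by linarith)
  linarith

/-- The shape of the per-box error as a function of its non-negative ingredients is non-negative (bookkeeping for `errPB_nonneg`).
[cite: BenfattoEtAl1978, (5.22) p.156, (5.29)–(5.31) p.157–158] -/
theorem err_shape_nonneg (t : ℕ) {K ε W : ℝ} {cχ δ₂₉ δ₃₁ : ℕ → ℝ} (hK : 0 ≤ K) (hε : 0 ≤ ε) (hW : 0 ≤ W)
    (hc : ∀ k, 0 ≤ cχ k) (h29 : ∀ k, 0 ≤ δ₂₉ k) (h31 : ∀ k, 0 ≤ δ₃₁ k) :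
    0 ≤ 2 * (2 ^ ((t + 1).choose 2) * K ^ (t + 1) / (t + 1)!) + Real.exp (2 * K) * W
        + ∑ k ∈ Finset.range t,
            (3 ^ (k + 1) * ((∑ π ∈ setPartitions (univ : Finset (Fin (k + 1))), ((π.card - 1)! : ℝ)) * (ε * K ^ k))
              + 3 ^ (k + 1) * (cχ (k + 1) + δ₂₉ (k + 1)) + 3 ^ (k + 1) * (cχ (k + 1) + δ₃₁ (k + 1))) / (k + 1)! := by
  refine add_nonneg (by positivity) (Finset.sum_nonneg fun k _ => ?_)
  have h1 := hc (k + 1)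
  have h2 := h29 (k + 1)
  have h3 := h31 (k + 1)
  positivity

/-- **The box-free per-box error bound is non-negative** (every term of `ErrPB` is a product of non-negative factors; needed to pass from
`Σ_{□∈B} Err(□) ≤ |B|·ErrPB` to `≤ |I|·ErrPB` when `|B| ≤ |I|`). [cite: BenfattoEtAl1978, p.159] -/
theorem errPB_nonneg {α β : ℝ} (hα : 0 < α) (hβ : 0 < β) {s D : ℕ} {κ : ℝ} (hκ : 0 ≤ κ) {A : ℝ} (hA : 0 ≤ A) {L w v : ℕ} (hL : 0 < L)
    {γ b : ℝ} (hγ : 0 ≤ γ) (hb : 0 ≤ b) {δ : ℝ} (hres : 0 ≤ κ / 2 - δ / 2 * ((D : ℝ) ^ 2 * Real.sqrt d)) (t : ℕ) :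
    0 ≤ (let M : ℝ := A * (L : ℝ) ^ d * ∑ p ∈ Finset.Icc 1 s, ((admissible p D).card : ℝ) *
            ((2 / (1 - Real.exp (-(κ / 2 / (p : ℕ) / Real.sqrt d))) * Real.exp (κ / 2 / (p : ℕ) / Real.sqrt d)) ^ d) ^ (p - 1)
        let Mt : ℝ := A * Real.exp (δ / 2 * ((D : ℝ) ^ 2 * d)) * (L : ℝ) ^ d * ∑ p ∈ Finset.Icc 1 s, ((admissible p D).card : ℝ) *
            ((2 / (1 - Real.exp (-((κ / 2 - δ / 2 * ((D : ℝ) ^ 2 * Real.sqrt d)) / (p : ℕ) / Real.sqrt d))) *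
              Real.exp ((κ / 2 - δ / 2 * ((D : ℝ) ^ 2 * Real.sqrt d)) / (p : ℕ) / Real.sqrt d)) ^ d) ^ (p - 1)
        let K : ℝ := 4 * (s1Const s D d κ * A * b ^ D * (L : ℝ) ^ d)
        let ε : ℝ := s1Const s D d κ * A * b ^ D * Real.exp (-(κ / 4 * v)) * (L : ℝ) ^ d
        let W : ℝ := 3 * (((L : ℝ) ^ d) * Real.exp (-(b ^ 2 / 4)))
        let cχ : ℕ → ℝ := fun k => 2 ^ k * ((∑ π ∈ setPartitions (univ : Finset (Fin k)), ((π.card - 1)! : ℝ)) *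
            ((min 1 (2 * ((L : ℝ) ^ d) * Real.exp (-(b ^ 2 / 4)))) ^ ((2 * k : ℕ) : ℝ)⁻¹ *
              ((1 + (1 + 2 * d / α ^ 2) * (γ * b)) ^ D * M * momentConst D (2 * k) (freeCov d α β 0 0).toNNReal) ^ k))
        let K₀ : ℝ := max (max 1 (freeCov d α β 0 0)) ((1 + 2 * d / α ^ 2) * (γ * b))
        let ε₃₁ : ℝ := max (β * (2 * d * (freeCov d α β 0 0 * (2 * d / (2 * d + α ^ 2)) ^ (w - v))) *
              (γ * b * ((L : ℝ) ^ d * (1 + Real.sqrt d * ((L : ℝ) - 1)))))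
            (2 * d * freeCov d α β 0 0 * (2 * d / (2 * d + α ^ 2)) ^ (w - v) / α ^ 2)
        let δ₂₉ : ℕ → ℝ := fun k => 2 ^ (k * D) * 2 ^ 2 ^ (k * D) * K₀ ^ (k * D) * Real.exp (-(δ / 2 * ((v : ℝ) + 1))) * Mt ^ k
        let δ₃₁ : ℕ → ℝ := fun k => M ^ k * (2 ^ (k * D) * 2 ^ 2 ^ (k * D) * ((k * D : ℕ) * K₀ ^ (k * D) * ε₃₁))
        let Err : ℝ := 2 * (2 ^ ((t + 1).choose 2) * K ^ (t + 1) / (t + 1)!) + Real.exp (2 * K) * W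
            + ∑ k ∈ Finset.range t,
                (3 ^ (k + 1) * ((∑ π ∈ setPartitions (univ : Finset (Fin (k + 1))), ((π.card - 1)! : ℝ)) * (ε * K ^ k))
                  + 3 ^ (k + 1) * (cχ (k + 1) + δ₂₉ (k + 1)) + 3 ^ (k + 1) * (cχ (k + 1) + δ₃₁ (k + 1))) / (k + 1)!
        Err) := by
  have hC : 0 ≤ freeCov d α β 0 0 := freeCov_nonneg hα hβ 0 0
  have hM1 := latticeSumConst_nonneg (s := s) (D := D) (d := d) (c := κ / 2) (by linarith)
  have hM2 := latticeSumConst_nonneg (s := s) (D := D) (d := d) (c := κ / 2 - δ / 2 * ((D : ℝ) ^ 2 * Real.sqrt d)) hres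
  have hmc : ∀ n : ℕ, 0 ≤ momentConst D n (freeCov d α β 0 0).toNNReal := fun n => by
    unfold momentConst; positivity
  have hS : 0 ≤ s1Const s D d κ := s1Const_nonneg s D d hκ
  have hθ : 0 ≤ (2 * d / (2 * d + α ^ 2) : ℝ) := by positivity
  have hε31 : 0 ≤ max (β * (2 * d * (freeCov d α β 0 0 * (2 * d / (2 * d + α ^ 2)) ^ (w - v))) *
        (γ * b * ((L : ℝ) ^ d * (1 + Real.sqrt d * ((L : ℝ) - 1)))))
      (2 * d * freeCov d α β 0 0 * (2 * d / (2 * d + α ^ 2)) ^ (w - v) / α ^ 2) :=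
    le_max_of_le_right (div_nonneg (mul_nonneg (mul_nonneg (by positivity) hC) (pow_nonneg hθ _)) (by positivity))
  exact err_shape_nonneg t (K := 4 * (s1Const s D d κ * A * b ^ D * (L : ℝ) ^ d)) (ε := s1Const s D d κ * A * b ^ D * Real.exp (-(κ / 4 * v)) * (L : ℝ) ^ d) (W := 3 * (((L : ℝ) ^ d) * Real.exp (-(b ^ 2 / 4))))
    (cχ := fun k => 2 ^ k * ((∑ π ∈ setPartitions (univ : Finset (Fin k)), ((π.card - 1)! : ℝ)) * ((min 1 (2 * ((L : ℝ) ^ d) * Real.exp (-(b ^ 2 / 4)))) ^ ((2 * k : ℕ) : ℝ)⁻¹ * ((1 + (1 + 2 * d / α ^ 2) * (γ * b)) ^ D * (A * (L : ℝ) ^ d * ∑ p ∈ Finset.Icc 1 s, ((admissible p D).card : ℝ) * ((2 / (1 - Real.exp (-(κ / 2 / (p : ℕ) / Real.sqrt d))) * Real.exp (κ / 2 / (p : ℕ) / Real.sqrt d)) ^ d) ^ (p - 1)) * momentConst D (2 * k) (freeCov d α β 0 0).toNNReal) ^ k)))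
    (δ₂₉ := fun k => 2 ^ (k * D) * 2 ^ 2 ^ (k * D) * (max (max 1 (freeCov d α β 0 0)) ((1 + 2 * d / α ^ 2) * (γ * b))) ^ (k * D) * Real.exp (-(δ / 2 * ((v : ℝ) + 1))) * (A * Real.exp (δ / 2 * ((D : ℝ) ^ 2 * d)) * (L : ℝ) ^ d * ∑ p ∈ Finset.Icc 1 s, ((admissible p D).card : ℝ) * ((2 / (1 - Real.exp (-((κ / 2 - δ / 2 * ((D : ℝ) ^ 2 * Real.sqrt d)) / (p : ℕ) / Real.sqrt d))) * Real.exp ((κ / 2 - δ / 2 * ((D : ℝ) ^ 2 * Real.sqrt d)) / (p : ℕ) / Real.sqrt d)) ^ d) ^ (p - 1)) ^ k)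
    (δ₃₁ := fun k => (A * (L : ℝ) ^ d * ∑ p ∈ Finset.Icc 1 s, ((admissible p D).card : ℝ) * ((2 / (1 - Real.exp (-(κ / 2 / (p : ℕ) / Real.sqrt d))) * Real.exp (κ / 2 / (p : ℕ) / Real.sqrt d)) ^ d) ^ (p - 1)) ^ k * (2 ^ (k * D) * 2 ^ 2 ^ (k * D) * ((k * D : ℕ) * (max (max 1 (freeCov d α β 0 0)) ((1 + 2 * d / α ^ 2) * (γ * b))) ^ (k * D) * (max (β * (2 * d * (freeCov d α β 0 0 * (2 * d / (2 * d + α ^ 2)) ^ (w - v))) * (γ * b * ((L : ℝ) ^ d * (1 + Real.sqrt d * ((L : ℝ) - 1))))) (2 * d * freeCov d α β 0 0 * (2 * d / (2 * d + α ^ 2)) ^ (w - v) / α ^ 2)))))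
    (by positivity) (by positivity) (by positivity)
    (fun k => by have := hmc (2 * k); positivity)
    (fun k => by positivity)
    (fun k => by positivity)

end Literature.MathematicalPhysics.QuantumFieldTheory.Balaban1983to89.B1Eq324BenfattoSect5PerBoxErrBound
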